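import Mathlib.Analysis.SpecialFunctions.Integrals.Basic
import Mathlib.LinearAlgebra.Matrix.Determinant.Basic
import Mathlib.Data.Matrix.Mul
import Literature.MathematicalPhysics.QuantumLattice.XYZGroundStateOrderIntegral
import HarnessLib

/-!
# Lattice points in a disc, counted by ROWS: `|det A|·#T ≤ π ρ² + (4|det A|/‖X‖ + 2‖X‖) ρ + |det A|`

HONEST FRAMING. Part of the venture `Summits/Ventures/Crystal3D` (cell `crystal3d-full`), helper for the cruxes
`CoaxialWallLaw` (stmt-Ventures-19481, the uniform F-U re-thread) and `GenericWallFloor` (stmt-Ventures-19480) of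
`route-Ventures-StickyWulffConstant`: the UNIFORM upper sample-deficit lemma `affineSampleDeficit_upper_unif`
(cf-p1 DECISION (lvii), 2026-08-28) counts the bond lines through a face of the clamped slab sample, i.e. the points of
a two-dimensional affine lattice in a disc, with an error LINEAR in the radius and INDEPENDENT of the shape of the
lattice's cell — the parallelogram count `affine_disc_count_upper` pays `π(ρ + r)²` with the cell diameter `r`, which
blows up for the elongated lattices of a grazing bond class.  Elementary; nothing about packings.

* `integral_sqrt_sq_sub_sq` — `∫₀^ρ √(ρ² − y²) = πρ²/4` (from the tree's `integral_sqrt_one_sub_sq_unit`, `∫₀¹ √(1 − x²) = π/4`).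
* **`sum_sqrt_sq_sub_sq_le_of_separated`** — for a finite `δ`-separated set `Y ⊆ [−ρ, ρ]`:
  `Σ_{y ∈ Y} √(ρ² − y²) ≤ πρ²/(2δ) + 2ρ` (the chord function is unimodal: `Finset.induction_on_max` and the antitone
  comparison with the integral on each side of `0`).
* `card_int_le_of_mem_Icc` — integers in a real interval `[lo, hi]` number at most `hi − lo + 1`.
* **`affine_disc_count_rows`** — for a real `2 × 2` matrix `A` with `det A ≠ 0`, an offset `b` and a finite `T ⊆ ℤ²` with
  `‖A z + b‖ ≤ ρ` on `T`:  `|det A| · #T ≤ π ρ² + (4|det A|/‖X‖ + 2‖X‖) ρ + |det A|`, where `X = A e₀` is the ROW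
  direction: the rows `z.2 = j` are arithmetic progressions of step `‖X‖` on parallel lines `|det A|/‖X‖` apart, each
  meets the disc in at most `chord/‖X‖ + 1` points, and the chords sum to `≤ (‖X‖/|det A|)·πρ²/… + 4ρ` by the
  separated-sum lemma.

WHAT THIS IS NOT: nothing three-dimensional yet (`…LineCountUnif` does the slab faces); F-C1 not moved.
-/

noncomputable section

namespace Summit.Ventures.Crystal3D.Theorems

open MeasureTheory Set Finset intervalIntegral

/-! ### The quarter disc -/

/-- `∫₀^ρ √(ρ² − y²) dy = πρ²/4` for `ρ ≥ 0`. -/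
theorem integral_sqrt_sq_sub_sq {ρ : ℝ} (hρ : 0 ≤ ρ) :
    ∫ y in (0 : ℝ)..ρ, Real.sqrt (ρ ^ 2 - y ^ 2) = Real.pi * ρ ^ 2 / 4 := by
  have h := intervalIntegral.smul_integral_comp_mul_left (a := (0 : ℝ)) (b := 1)
    (f := fun y : ℝ => Real.sqrt (ρ ^ 2 - y ^ 2)) ρ
  rw [mul_zero, mul_one] at h
  rw [← h]
  have hpt : ∀ x : ℝ, Real.sqrt (ρ ^ 2 - (ρ * x) ^ 2) = ρ * Real.sqrt (1 - x ^ 2) := by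
    intro x
    rw [show ρ ^ 2 - (ρ * x) ^ 2 = ρ ^ 2 * (1 - x ^ 2) by ring, Real.sqrt_mul (sq_nonneg ρ), Real.sqrt_sq hρ]
  simp_rw [hpt]
  rw [intervalIntegral.integral_const_mul,
    Literature.MathematicalPhysics.QuantumLattice.integral_sqrt_one_sub_sq_unit, smul_eq_mul]
  ring

/-! ### Separated sums of the chord function -/

/-- The chord function is bounded by `ρ`. -/
theorem sqrt_sq_sub_sq_le {ρ : ℝ} (hρ : 0 ≤ ρ) (y : ℝ) : Real.sqrt (ρ ^ 2 - y ^ 2) ≤ ρ := by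
  calc Real.sqrt (ρ ^ 2 - y ^ 2) ≤ Real.sqrt (ρ ^ 2) := Real.sqrt_le_sqrt (by nlinarith [sq_nonneg y])
    _ = ρ := Real.sqrt_sq hρ

/-- The chord function is antitone on `[0, ∞)`. -/
theorem sqrt_sq_sub_sq_antitone (ρ : ℝ) {x y : ℝ} (hx : 0 ≤ x) (hxy : x ≤ y) :
    Real.sqrt (ρ ^ 2 - y ^ 2) ≤ Real.sqrt (ρ ^ 2 - x ^ 2) :=
  Real.sqrt_le_sqrt (by nlinarith)

/-- **One side.**  A finite `δ`-separated set of reals in `[0, M]` (`M ≤ ρ` not needed) has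
`Σ √(ρ² − y²) ≤ ρ + (1/δ) ∫₀^M √(ρ² − y²)`. -/
theorem sum_sqrt_le_of_separated_nonneg {ρ δ : ℝ} (hρ : 0 ≤ ρ) (hδ : 0 < δ) (S : Finset ℝ) :
    (∀ y ∈ S, 0 ≤ y) → (∀ y ∈ S, ∀ y' ∈ S, y ≠ y' → δ ≤ |y - y'|) →
      ∀ M : ℝ, (∀ y ∈ S, y ≤ M) → 0 ≤ M →
        ∑ y ∈ S, Real.sqrt (ρ ^ 2 - y ^ 2) ≤ ρ + 1 / δ * ∫ y in (0 : ℝ)..M, Real.sqrt (ρ ^ 2 - y ^ 2) := by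
  have hcont : Continuous fun y : ℝ => Real.sqrt (ρ ^ 2 - y ^ 2) := by fun_prop
  have hint : ∀ a b : ℝ, IntervalIntegrable (fun y : ℝ => Real.sqrt (ρ ^ 2 - y ^ 2)) volume a b :=
    fun a b => hcont.intervalIntegrable a b
  have hInn : ∀ M : ℝ, 0 ≤ M → 0 ≤ ∫ y in (0 : ℝ)..M, Real.sqrt (ρ ^ 2 - y ^ 2) :=
    fun M hM => intervalIntegral.integral_nonneg hM fun _ _ => Real.sqrt_nonneg _
  induction S using Finset.induction_on_max with
  | empty =>
    intro _ _ M _ hM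
    rw [sum_empty]
    have := hInn M hM
    have : 0 ≤ 1 / δ * ∫ y in (0 : ℝ)..M, Real.sqrt (ρ ^ 2 - y ^ 2) := by positivity
    linarith
  | insert a s hlt ih =>
    intro hpos hsep M hM hM0
    have has : a ∉ s := fun h => lt_irrefl a (hlt a h)
    rw [sum_insert has]
    have haM : a ≤ M := hM a (mem_insert_self a s)
    have ha0 : 0 ≤ a := hpos a (mem_insert_self a s)
    by_cases hs : s = ∅
    · subst hs
      rw [sum_empty, add_zero]
      have h1 := sqrt_sq_sub_sq_le hρ a
      have h2 : 0 ≤ 1 / δ * ∫ y in (0 : ℝ)..M, Real.sqrt (ρ ^ 2 - y ^ 2) := by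
        have := hInn M hM0; positivity
      linarith
    · obtain ⟨x₀, hx₀⟩ := Finset.nonempty_iff_ne_empty.2 hs
      -- every element of `s` is `≤ a − δ`
      have hsle : ∀ y ∈ s, y ≤ a - δ := by
        intro y hy
        have hya : y < a := hlt y hy
        have h := hsep a (mem_insert_self a s) y (mem_insert_of_mem hy) (ne_of_gt hya)
        rw [abs_of_pos (by linarith)] at h
        linarith
      have hx₀0 : 0 ≤ x₀ := hpos x₀ (mem_insert_of_mem hx₀)
      have haδ : 0 ≤ a - δ := le_trans hx₀0 (hsle x₀ hx₀)
      have ih' := ih (fun y hy => hpos y (mem_insert_of_mem hy))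
        (fun y hy y' hy' hne => hsep y (mem_insert_of_mem hy) y' (mem_insert_of_mem hy') hne) (a - δ) hsle haδ
      -- `√(ρ² − a²)·δ ≤ ∫_{a−δ}^{a}`
      have hstep : Real.sqrt (ρ ^ 2 - a ^ 2) * δ ≤ ∫ y in (a - δ)..a, Real.sqrt (ρ ^ 2 - y ^ 2) := by
        have hc : ∫ _ in (a - δ)..a, Real.sqrt (ρ ^ 2 - a ^ 2) = Real.sqrt (ρ ^ 2 - a ^ 2) * δ := by
          rw [intervalIntegral.integral_const, smul_eq_mul]; ring
        rw [← hc]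
        exact intervalIntegral.integral_mono_on (by linarith) intervalIntegrable_const (hint _ _)
          fun y hy => sqrt_sq_sub_sq_antitone ρ (le_trans haδ hy.1) hy.2
      have hsplit : (∫ y in (0 : ℝ)..(a - δ), Real.sqrt (ρ ^ 2 - y ^ 2)) +
          ∫ y in (a - δ)..a, Real.sqrt (ρ ^ 2 - y ^ 2) = ∫ y in (0 : ℝ)..a, Real.sqrt (ρ ^ 2 - y ^ 2) :=
        integral_add_adjacent_intervals (hint _ _) (hint _ _)
      have hmono : ∫ y in (0 : ℝ)..a, Real.sqrt (ρ ^ 2 - y ^ 2) ≤ ∫ y in (0 : ℝ)..M, Real.sqrt (ρ ^ 2 - y ^ 2) :=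
        intervalIntegral.integral_mono_interval le_rfl ha0 haM
          (Filter.Eventually.of_forall fun _ => Real.sqrt_nonneg _) (hint _ _)
      have hδinv : 0 < 1 / δ := by positivity
      have hkey' : Real.sqrt (ρ ^ 2 - a ^ 2) ≤ 1 / δ * ∫ y in (a - δ)..a, Real.sqrt (ρ ^ 2 - y ^ 2) := by
        rw [one_div, ← div_eq_inv_mul, le_div_iff₀ hδ]; exact hstep
      set I₁ := ∫ y in (0 : ℝ)..(a - δ), Real.sqrt (ρ ^ 2 - y ^ 2) with hI₁
      set I₂ := ∫ y in (a - δ)..a, Real.sqrt (ρ ^ 2 - y ^ 2) with hI₂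
      set Ia := ∫ y in (0 : ℝ)..a, Real.sqrt (ρ ^ 2 - y ^ 2) with hIa
      set IM := ∫ y in (0 : ℝ)..M, Real.sqrt (ρ ^ 2 - y ^ 2) with hIM
      have h3 := mul_le_mul_of_nonneg_left hmono hδinv.le
      calc Real.sqrt (ρ ^ 2 - a ^ 2) + ∑ y ∈ s, Real.sqrt (ρ ^ 2 - y ^ 2)
          ≤ 1 / δ * I₂ + (ρ + 1 / δ * I₁) := add_le_add hkey' ih'
        _ = ρ + 1 / δ * Ia := by rw [← hsplit]; ring
        _ ≤ ρ + 1 / δ * IM := by linarith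


/-- **Separated sums of the chord function.**  A finite `δ`-separated set `Y ⊆ [−ρ, ρ]` has
`Σ_{y ∈ Y} √(ρ² − y²) ≤ πρ²/(2δ) + 2ρ`. -/
theorem sum_sqrt_sq_sub_sq_le_of_separated {ρ δ : ℝ} (hρ : 0 ≤ ρ) (hδ : 0 < δ) (Y : Finset ℝ)
    (hY : ∀ y ∈ Y, |y| ≤ ρ) (hsep : ∀ y ∈ Y, ∀ y' ∈ Y, y ≠ y' → δ ≤ |y - y'|) :
    ∑ y ∈ Y, Real.sqrt (ρ ^ 2 - y ^ 2) ≤ Real.pi * ρ ^ 2 / (2 * δ) + 2 * ρ := by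
  classical
  have hI := integral_sqrt_sq_sub_sq hρ
  -- the nonnegative part
  set Yp := Y.filter fun y => 0 ≤ y with hYp
  set Yn := Y.filter fun y => ¬ 0 ≤ y with hYn
  have hsplit : ∑ y ∈ Y, Real.sqrt (ρ ^ 2 - y ^ 2) =
      ∑ y ∈ Yp, Real.sqrt (ρ ^ 2 - y ^ 2) + ∑ y ∈ Yn, Real.sqrt (ρ ^ 2 - y ^ 2) :=
    (sum_filter_add_sum_filter_not Y (fun y => 0 ≤ y) _).symm
  have hp : ∑ y ∈ Yp, Real.sqrt (ρ ^ 2 - y ^ 2) ≤ ρ + 1 / δ * (Real.pi * ρ ^ 2 / 4) := by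
    rw [← hI]
    refine sum_sqrt_le_of_separated_nonneg hρ hδ Yp (fun y hy => (mem_filter.1 hy).2)
      (fun y hy y' hy' hne => hsep y (mem_filter.1 hy).1 y' (mem_filter.1 hy').1 hne) ρ
      (fun y hy => (abs_le.1 (hY y (mem_filter.1 hy).1)).2) hρ
  -- the negative part, reflected
  set Ym := Yn.image fun y : ℝ => -y with hYm
  have hinj : Set.InjOn (fun y : ℝ => -y) ↑Yn := fun y _ y' _ h => neg_injective h
  have hn : ∑ y ∈ Yn, Real.sqrt (ρ ^ 2 - y ^ 2) = ∑ y ∈ Ym, Real.sqrt (ρ ^ 2 - y ^ 2) := by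
    rw [hYm, sum_image hinj]
    simp only [even_two, Even.neg_pow]
  have hm : ∑ y ∈ Ym, Real.sqrt (ρ ^ 2 - y ^ 2) ≤ ρ + 1 / δ * (Real.pi * ρ ^ 2 / 4) := by
    rw [← hI]
    refine sum_sqrt_le_of_separated_nonneg hρ hδ Ym ?_ ?_ ρ ?_ hρ
    · intro y hy
      obtain ⟨y', hy', rfl⟩ := mem_image.1 hy
      have := (mem_filter.1 hy').2
      linarith
    · intro y hy z hz hne
      obtain ⟨y', hy', rfl⟩ := mem_image.1 hy
      obtain ⟨z', hz', rfl⟩ := mem_image.1 hz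
      have h := hsep y' (mem_filter.1 hy').1 z' (mem_filter.1 hz').1 (fun e => hne (by rw [e]))
      rwa [show -y' - -z' = -(y' - z') by ring, abs_neg]
    · intro y hy
      obtain ⟨y', hy', rfl⟩ := mem_image.1 hy
      exact (abs_le.1 (hY y' (mem_filter.1 hy').1)).1 |> fun h => by linarith
  rw [hsplit, hn]
  have : ρ + 1 / δ * (Real.pi * ρ ^ 2 / 4) + (ρ + 1 / δ * (Real.pi * ρ ^ 2 / 4)) =
      Real.pi * ρ ^ 2 / (2 * δ) + 2 * ρ := by field_simp; ring
  linarith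

/-! ### Integers in an interval -/

/-- Integers in a real interval `[lo, hi]` (`lo ≤ hi`) number at most `hi − lo + 1`. -/
theorem card_int_le_of_mem_Icc (S : Finset ℤ) {lo hi : ℝ} (hlohi : lo ≤ hi)
    (h : ∀ i ∈ S, lo ≤ (i : ℝ) ∧ (i : ℝ) ≤ hi) : (S.card : ℝ) ≤ hi - lo + 1 := by
  have hsub : S ⊆ Finset.Icc ⌈lo⌉ ⌊hi⌋ := by
    intro i hi'
    obtain ⟨h1, h2⟩ := h i hi'
    exact Finset.mem_Icc.2 ⟨Int.ceil_le.2 h1, Int.le_floor.2 h2⟩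
  have hcard := Finset.card_le_card hsub
  rw [Int.card_Icc] at hcard
  have hc : (S.card : ℝ) ≤ ((⌊hi⌋ + 1 - ⌈lo⌉).toNat : ℝ) := by exact_mod_cast hcard
  refine hc.trans ?_
  rcases le_or_gt 0 (⌊hi⌋ + 1 - ⌈lo⌉) with hnn | hneg
  · have e : (((⌊hi⌋ + 1 - ⌈lo⌉).toNat : ℤ) : ℝ) = ((⌊hi⌋ + 1 - ⌈lo⌉ : ℤ) : ℝ) := by
      rw [Int.toNat_of_nonneg hnn]
    rw [Int.cast_natCast] at e
    rw [e]; push_cast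
    linarith [Int.floor_le hi, Int.le_ceil lo]
  · rw [Int.toNat_eq_zero.2 hneg.le]; push_cast; linarith

/-! ### The row count -/

/-- **Lattice points in a disc, counted by rows.**  For a real `2 × 2` matrix `A` with `det A ≠ 0`, an offset `b`,
`ρ ≥ 0`, and a finite `T ⊆ ℤ²` with `‖A z + b‖ ≤ ρ` for `z ∈ T`:
`|det A| · #T ≤ π ρ² + (4 |det A| / ‖X‖ + 2 ‖X‖) ρ + |det A|`, `‖X‖ = √(A₀₀² + A₁₀²)` the norm of the row step. -/
theorem affine_disc_count_rows (A : Matrix (Fin 2) (Fin 2) ℝ) (hA : A.det ≠ 0) (b : Fin 2 → ℝ)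
    (ρ : ℝ) (hρ : 0 ≤ ρ) (T : Finset (ℤ × ℤ))
    (hT : ∀ z ∈ T,
      (A.mulVec ![(z.1 : ℝ), (z.2 : ℝ)] 0 + b 0) ^ 2 + (A.mulVec ![(z.1 : ℝ), (z.2 : ℝ)] 1 + b 1) ^ 2 ≤ ρ ^ 2) :
    |A.det| * (T.card : ℝ) ≤
      Real.pi * ρ ^ 2 + (4 * |A.det| / Real.sqrt (A 0 0 ^ 2 + A 1 0 ^ 2) +
        2 * Real.sqrt (A 0 0 ^ 2 + A 1 0 ^ 2)) * ρ + |A.det| := by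
  classical
  set X0 := A 0 0 with hX0
  set X1 := A 1 0 with hX1
  set Y0 := A 0 1 with hY0
  set Y1 := A 1 1 with hY1
  set d := A.det with hd
  have hdet : d = X0 * Y1 - Y0 * X1 := by rw [hd, Matrix.det_fin_two]
  set nX := Real.sqrt (X0 ^ 2 + X1 ^ 2) with hnX
  have hXsq : 0 < X0 ^ 2 + X1 ^ 2 := by
    by_contra hle
    push Not at hle
    have h0 : X0 = 0 := by nlinarith [sq_nonneg X0, sq_nonneg X1]
    have h1 : X1 = 0 := by nlinarith [sq_nonneg X0, sq_nonneg X1]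
    apply hA; rw [hdet, h0, h1]; ring
  have hnXpos : 0 < nX := Real.sqrt_pos.2 hXsq
  have hnXsq : nX ^ 2 = X0 ^ 2 + X1 ^ 2 := Real.sq_sqrt hXsq.le
  have hdpos : 0 < |d| := abs_pos.2 hA
  -- coordinates of the points
  have hv0 : ∀ z : ℤ × ℤ, A.mulVec ![(z.1 : ℝ), (z.2 : ℝ)] 0 = X0 * z.1 + Y0 * z.2 := by
    intro z; rw [hX0, hY0]; simp [Matrix.mulVec, dotProduct, Fin.sum_univ_two]
  have hv1 : ∀ z : ℤ × ℤ, A.mulVec ![(z.1 : ℝ), (z.2 : ℝ)] 1 = X1 * z.1 + Y1 * z.2 := by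
    intro z; rw [hX1, hY1]; simp [Matrix.mulVec, dotProduct, Fin.sum_univ_two]
  -- the row offset and the row height
  set x : ℤ → ℝ := fun j => ((X0 * Y0 + X1 * Y1) * j + X0 * b 0 + X1 * b 1) / nX with hx
  set y : ℤ → ℝ := fun j => (d * j + (X0 * b 1 - X1 * b 0)) / nX with hy
  have hcoords : ∀ z ∈ T, (nX * z.1 + x z.2) ^ 2 + (y z.2) ^ 2 ≤ ρ ^ 2 := by
    intro z hz
    have h := hT z hz
    rw [hv0 z, hv1 z] at h
    have hne : nX ≠ 0 := hnXpos.ne'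
    have hPx : nX * x z.2 = (X0 * Y0 + X1 * Y1) * z.2 + X0 * b 0 + X1 * b 1 := by
      rw [hx]; field_simp
    have hQy : nX * y z.2 = d * z.2 + (X0 * b 1 - X1 * b 0) := by
      rw [hy]; field_simp
    have e : nX ^ 2 * ((nX * z.1 + x z.2) ^ 2 + (y z.2) ^ 2) =
        nX ^ 2 * ((X0 * z.1 + Y0 * z.2 + b 0) ^ 2 + (X1 * z.1 + Y1 * z.2 + b 1) ^ 2) := by
      have lhs : nX ^ 2 * ((nX * z.1 + x z.2) ^ 2 + (y z.2) ^ 2) =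
          (nX ^ 2 * z.1 + nX * x z.2) ^ 2 + (nX * y z.2) ^ 2 := by ring
      rw [lhs, hPx, hQy, hnXsq, hdet]; ring
    have hnX2 : 0 < nX ^ 2 := by positivity
    have h' : nX ^ 2 * ((nX * z.1 + x z.2) ^ 2 + (y z.2) ^ 2) ≤ nX ^ 2 * ρ ^ 2 := by
      rw [e]; exact mul_le_mul_of_nonneg_left h hnX2.le
    exact le_of_mul_le_mul_left h' hnX2
  -- the chord of row `j`
  set c : ℤ → ℝ := fun j => Real.sqrt (ρ ^ 2 - (y j) ^ 2) with hc
  -- the rows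
  set J := T.image Prod.snd with hJ
  have hTsum : (T.card : ℝ) = ∑ j ∈ J, ((T.filter fun z => z.2 = j).card : ℝ) := by
    rw [card_eq_sum_card_fiberwise (f := Prod.snd) (t := J) fun z hz => mem_image_of_mem _ hz]
    push_cast; rfl
  -- one row
  have hrow : ∀ j ∈ J, ((T.filter fun z => z.2 = j).card : ℝ) ≤ 2 * c j / nX + 1 := by
    intro j _
    set F := T.filter fun z => z.2 = j with hF
    have hinj : Set.InjOn (Prod.fst : ℤ × ℤ → ℤ) (F : Set (ℤ × ℤ)) := by
      intro z hz z' hz' h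
      have h2 : z.2 = z'.2 := by
        rw [(mem_filter.1 (mem_coe.1 hz)).2, (mem_filter.1 (mem_coe.1 hz')).2]
      exact Prod.ext h h2
    have hcardF : (F.card : ℝ) = ((F.image Prod.fst).card : ℝ) := by rw [card_image_of_injOn hinj]
    rw [hcardF]
    have hbound : ∀ i ∈ F.image Prod.fst, (-c j - x j) / nX ≤ (i : ℝ) ∧ (i : ℝ) ≤ (c j - x j) / nX := by
      intro i hi
      obtain ⟨z, hz, rfl⟩ := mem_image.1 hi
      obtain ⟨hzT, hzj⟩ := mem_filter.1 hz
      have h := hcoords z hzT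
      rw [hzj] at h
      have hsq : (nX * z.1 + x j) ^ 2 ≤ ρ ^ 2 - (y j) ^ 2 := by linarith [sq_nonneg (y j)]
      have habs : |nX * z.1 + x j| ≤ c j := by
        rw [hc]; exact Real.abs_le_sqrt hsq
      obtain ⟨h1, h2⟩ := abs_le.1 habs
      constructor
      · rw [div_le_iff₀ hnXpos]; linarith
      · rw [le_div_iff₀ hnXpos]; linarith
    have hcj : 0 ≤ c j := Real.sqrt_nonneg _
    have := card_int_le_of_mem_Icc (F.image Prod.fst) (by
      rw [div_le_div_iff_of_pos_right hnXpos]; linarith) hbound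
    have e : (c j - x j) / nX - (-c j - x j) / nX + 1 = 2 * c j / nX + 1 := by field_simp; ring
    rw [e] at this; exact this
  -- the heights of the rows are `|d|/nX`-separated and within `[−ρ, ρ]`
  set δ := |d| / nX with hδ
  have hδpos : 0 < δ := div_pos hdpos hnXpos
  have hyabs : ∀ j ∈ J, |y j| ≤ ρ := by
    intro j hj
    obtain ⟨z, hz, rfl⟩ := mem_image.1 hj
    have h := hcoords z hz
    have : (y z.2) ^ 2 ≤ ρ ^ 2 := by nlinarith [sq_nonneg (nX * z.1 + x z.2)]
    exact abs_le_of_sq_le_sq' this hρ |> fun h => abs_le.2 h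
  have hysep : ∀ j j' : ℤ, j ≠ j' → δ ≤ |y j - y j'| := by
    intro j j' hne
    have e : y j - y j' = d * ((j : ℝ) - j') / nX := by rw [hy]; field_simp; ring
    rw [e, abs_div, abs_mul, abs_of_pos hnXpos, hδ, div_le_div_iff_of_pos_right hnXpos]
    have h1 : (1 : ℝ) ≤ |(j : ℝ) - j'| := by
      have : (1 : ℤ) ≤ |j - j'| := Int.one_le_abs (sub_ne_zero.2 hne)
      have h' : ((1 : ℤ) : ℝ) ≤ ((|j - j'| : ℤ) : ℝ) := by exact_mod_cast this
      push_cast at h'; exact h'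
    nlinarith [abs_nonneg d]
  have hyinj : Set.InjOn y ↑J := by
    intro j _ j' _ h
    by_contra hne
    have := hysep j j' hne
    rw [h, sub_self, abs_zero] at this
    exact absurd this (not_le.2 hδpos)
  -- the chords sum by the separated-sum lemma
  have hchords : ∑ j ∈ J, c j ≤ Real.pi * ρ ^ 2 / (2 * δ) + 2 * ρ := by
    have e : ∑ j ∈ J, c j = ∑ u ∈ J.image y, Real.sqrt (ρ ^ 2 - u ^ 2) := by
      rw [sum_image hyinj]
    rw [e]
    refine sum_sqrt_sq_sub_sq_le_of_separated hρ hδpos (J.image y) ?_ ?_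
    · intro u hu
      obtain ⟨j, hj, rfl⟩ := mem_image.1 hu
      exact hyabs j hj
    · intro u hu u' hu' hne
      obtain ⟨j, hj, rfl⟩ := mem_image.1 hu
      obtain ⟨j', hj', rfl⟩ := mem_image.1 hu'
      exact hysep j j' fun e => hne (by rw [e])
  -- the number of rows
  have hJcard : (J.card : ℝ) ≤ 2 * ρ / δ + 1 := by
    have hw : ∀ j ∈ J, |d * j + (X0 * b 1 - X1 * b 0)| ≤ ρ * nX := by
      intro j hj
      have h := hyabs j hj
      rw [hy, abs_div, abs_of_pos hnXpos, div_le_iff₀ hnXpos] at h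
      exact h
    set w := X0 * b 1 - X1 * b 0 with hw'
    rcases lt_or_gt_of_ne hA with hneg | hpos
    · -- `d < 0`
      have hd' : d < 0 := hneg
      have hb : ∀ j ∈ J, (ρ * nX - w) / d ≤ (j : ℝ) ∧ (j : ℝ) ≤ (-(ρ * nX) - w) / d := by
        intro j hj
        obtain ⟨h1, h2⟩ := abs_le.1 (hw j hj)
        constructor
        · rw [div_le_iff_of_neg hd']; linarith
        · rw [le_div_iff_of_neg hd']; linarith
      have hlohi : (ρ * nX - w) / d ≤ (-(ρ * nX) - w) / d :=
        (div_le_div_right_of_neg hd').2 (by nlinarith [hnXpos, hρ])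
      have := card_int_le_of_mem_Icc J hlohi hb
      have e : (-(ρ * nX) - w) / d - (ρ * nX - w) / d + 1 = 2 * ρ / δ + 1 := by
        rw [hδ, abs_of_neg hd']; field_simp; ring
      rw [e] at this; exact this
    · -- `d > 0`
      have hd' : 0 < d := hpos
      have hb : ∀ j ∈ J, (-(ρ * nX) - w) / d ≤ (j : ℝ) ∧ (j : ℝ) ≤ (ρ * nX - w) / d := by
        intro j hj
        obtain ⟨h1, h2⟩ := abs_le.1 (hw j hj)
        constructor
        · rw [div_le_iff₀ hd']; linarith
        · rw [le_div_iff₀ hd']; linarith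
      have := card_int_le_of_mem_Icc J (by rw [div_le_div_iff_of_pos_right hd']; nlinarith [hnXpos, hρ]) hb
      have e : (ρ * nX - w) / d - (-(ρ * nX) - w) / d + 1 = 2 * ρ / δ + 1 := by
        rw [hδ, abs_of_pos hd']; field_simp; ring
      rw [e] at this; exact this
  -- assemble
  have hsum : (T.card : ℝ) ≤ 2 / nX * (Real.pi * ρ ^ 2 / (2 * δ) + 2 * ρ) + (2 * ρ / δ + 1) := by
    rw [hTsum]
    calc ∑ j ∈ J, ((T.filter fun z => z.2 = j).card : ℝ) ≤ ∑ j ∈ J, (2 * c j / nX + 1) := sum_le_sum hrow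
      _ = 2 / nX * ∑ j ∈ J, c j + J.card := by
          rw [sum_add_distrib, sum_const, nsmul_eq_mul, mul_one, mul_sum]
          congr 1; exact sum_congr rfl fun j _ => by ring
      _ ≤ 2 / nX * (Real.pi * ρ ^ 2 / (2 * δ) + 2 * ρ) + (2 * ρ / δ + 1) := by
          have h2 : 0 ≤ 2 / nX := by positivity
          nlinarith [mul_le_mul_of_nonneg_left hchords h2, hJcard]
  have hdnX : |d| = δ * nX := by rw [hδ]; field_simp
  have hfinal : |d| * (2 / nX * (Real.pi * ρ ^ 2 / (2 * δ) + 2 * ρ) + (2 * ρ / δ + 1)) =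
      Real.pi * ρ ^ 2 + (4 * |d| / nX + 2 * nX) * ρ + |d| := by
    rw [hdnX]; field_simp; ring
  calc |d| * (T.card : ℝ) ≤ |d| * (2 / nX * (Real.pi * ρ ^ 2 / (2 * δ) + 2 * ρ) + (2 * ρ / δ + 1)) :=
        mul_le_mul_of_nonneg_left hsum hdpos.le
    _ = Real.pi * ρ ^ 2 + (4 * |d| / nX + 2 * nX) * ρ + |d| := hfinal

end Summit.Ventures.Crystal3D.Theorems

end
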